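import Mathlib
import Literature.Analysis.UnboundedOperators.ConjugateOperatorRegularity
import Literature.Analysis.UnboundedOperators.UnitaryRepSpectralMeasure
import Literature.Analysis.UnboundedOperators.FourierSpectrumCalculus
import HarnessLib
import Summits.AtomisticToContinuum.FouriersLaw.Theorems.EmbeddedDrudeMourreMourreDissolutionLAPDifferentialInequality
import Summits.AtomisticToContinuum.FouriersLaw.Theorems.EmbeddedDrudeMourreMourreDissolutionLAPMourreCommutatorForm
import Summits.AtomisticToContinuum.FouriersLaw.Theorems.EmbeddedDrudeMourreMourreDissolutionLAPEnergyLocalisation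
import Summits.AtomisticToContinuum.FouriersLaw.Theorems.EmbeddedDrudeMourreMourreDissolutionLAPCommutatorExpansionError
import Summits.AtomisticToContinuum.FouriersLaw.Theorems.EmbeddedDrudeMourreMourreDissolutionLAPUniformCauchy

/-!
# Stub `stub_mourreThresholdLAP` — F4 (part 2/2): the differential inequality and the uniform bounds

Item `stmt-AtomisticToContinuum-12594` (crux `MourreDissolution` of route `EmbeddedDrudeMourre`,
sub-problem `FouriersLaw`), line `separable-vertex-faddeev-pair-sector`, stub S6
`stub_mourreThresholdLAP` (Mourre's limiting absorption principle, `C²` form), helper F4 of the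
proof map (Mourre 1981; ABG = Amrein–Boutet de Monvel–Georgescu 1996, proof of Thm. 7.3.1,
eqs. (7.3.10)–(7.3.12)), part 2/2: MOURRE'S DIFFERENTIAL INEQUALITY for
`F_ε = ⟪f, G_ε(ω - iν) f⟫`, `f ∈ D(A)`, with constants uniform in `ω ∈ [l', r']`, `ν ∈ (0, 1]`,
and the resulting uniform bounds consumed by the `ε`-integration of `…LAPUniformCauchy`.

Setting: the hypotheses of the stub (`H ∈ C¹(A)`, a strict Mourre estimate on `(l, r)` with
constant `a > 0`, `φ(H)[H, iA]φ(H) ∈ C¹(A; H)` for admissible cutoffs), a compact energy window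
`[l', r'] ⊂ (l, r)`, a PLATEAU CUTOFF `g` (`φ = g(·/2π) ≡ 1` on `[l' - δ', r' + δ']`,
`0 ≤ φ ≤ 1`, `exists_plateauCutoff`), `Φ = φ(H)`, `M = U.mourreCommutator A g` (self-adjoint,
`≥ 0`, Mourre inequality `a‖Φ v‖² ≤ Re ⟪v, M v⟫`), `G_ε(z) = mourreG U M ε z`, `z = ω - iν`,
`z₀ = ω - i`.

* §1 the geometry of `z = ω - iν`, `z₀ = ω - i` and the uniform bound
  `‖[R(ω - i), iA]‖ ≤ (1 + Ω)² ‖[R(-i), iA]‖` (`|ω| ≤ Ω`);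
* §2 the localised transition factors: `‖(1 - Φ)(1 + (z - z₀)R(z))‖ ≤ 1 + 1/δ'`,
  `‖(1 + (z - z₀)R(z))(1 - Φ)‖ ‖Φ‖ ≤ 1 + 1/δ'` (energy localisation `‖(1 - Φ)R(z)‖ ≤ 1/δ'`);
* §3 THE DIFFERENTIAL INEQUALITY at `(ω, ν, ε)`:
  `‖⟪f, G_ε M G_ε f⟫‖ ≤ η₀ + c₁ (√ε)⁻¹ √‖F_ε‖ + ψ₀ ‖F_ε‖` (the sandwich bound of
  `…LAPCommutatorExpansionError`, the quadratic estimates of `…LAPQuadraticEstimate` for `G` and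
  `G†`, and the bookkeeping lemma of `…LAPDifferentialInequality`);
* §4 THE UNIFORM BOUNDS (headline `exists_mourre_derivative_bounds`): `ε₀ > 0`, `C`, and an
  integrable `κ` with `‖G_ε(ω - iν)‖ ≤ C/ε` on `(0, ε₀]` and `‖⟪f, G_ε M G_ε f⟫‖ ≤ κ(ε)` on
  `(0, ε₀)`, uniformly in `ω ∈ [l', r']`, `ν ∈ (0, 1]` (Gronwall step of
  `…LAPDifferentialInequality`).
-/

noncomputable section

open MeasureTheory Complex Filter Topology Set
open scoped InnerProductSpace ComplexConjugate SchwartzMap ENNReal NNReal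

namespace Summit.AtomisticToContinuum.FouriersLaw.Theorems.MourreDissolution

open Literature.Analysis.UnboundedOperators
open Literature.Analysis.UnboundedOperators.UnitaryRep

variable {H : Type*} [NormedAddCommGroup H] [InnerProductSpace ℂ H] [CompleteSpace H]

/-! ## §1. Geometry of `z = ω - iν`, `z₀ = ω - i`; the uniform commutator bound at `z₀` -/

/-- `Im (ω - i) = -1`. [folklore] -/
theorem im_ofReal_sub_I (ω : ℝ) : ((ω : ℂ) - I).im = -1 := by simp

/-- `Re (ω - iν) = ω`. [folklore] -/
theorem re_ofReal_sub_I_mul (ω ν : ℝ) : ((ω : ℂ) - I * ν).re = ω := by simp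

/-- `Im conj (ω - iν) = ν`. [folklore] -/
theorem im_conj_ofReal_sub_I_mul (ω ν : ℝ) : (conj ((ω : ℂ) - I * ν)).im = ν := by simp

/-- `Re conj (ω - iν) = ω`. [folklore] -/
theorem re_conj_ofReal_sub_I_mul (ω ν : ℝ) : (conj ((ω : ℂ) - I * ν)).re = ω := by simp

/-- `‖(ω - iν) - (ω - i)‖ = |1 - ν|`. [folklore] -/
theorem norm_ofReal_sub_I_mul_sub_ofReal_sub_I (ω ν : ℝ) :
    ‖((ω : ℂ) - I * ν) - ((ω : ℂ) - I)‖ = |1 - ν| := by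
  have : ((ω : ℂ) - I * ν) - ((ω : ℂ) - I) = I * ((1 - ν : ℝ) : ℂ) := by push_cast; ring
  rw [this, norm_mul, Complex.norm_I, one_mul, Complex.norm_real, Real.norm_eq_abs]

/-- **Uniform bound on `[R(ω - i), iA]`**: `‖[R(ω - i), iA]‖ ≤ (1 + Ω)² ‖[R(-i), iA]‖` for
`|ω| ≤ Ω` (`norm_commutatorCLM_resolventAt_le` with `|Im z₀| = 1`, `|z₀ + i| = |ω|`).
[cite: AmreinBoutetdeMonvelGeorgescu1996, Lemma 6.2.1] -/
theorem norm_commutatorCLM_resolventAt_ofReal_sub_I_le {U A : OneParameterUnitaryGroup H}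
    (hC1 : U.HamiltonianOfClassC1 A) {ω Ω : ℝ} (hω : |ω| ≤ Ω) :
    ‖A.commutatorCLM (resolventAt U ((ω : ℂ) - I))‖ ≤
      (1 + Ω) ^ 2 * ‖A.commutatorCLM (resolventAt U (-I))‖ := by
  have hz₀ : ((ω : ℂ) - I).im ≠ 0 := by rw [im_ofReal_sub_I]; norm_num
  refine (norm_commutatorCLM_resolventAt_le hC1 hz₀).trans ?_
  rw [sub_add_cancel, im_ofReal_sub_I, Complex.norm_real, Real.norm_eq_abs, abs_neg, abs_one,
    inv_one, mul_one]
  gcongr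

/-! ## §2. The localised transition factors -/

/-- The plateau hypothesis at `ω ∈ [l', r']` from the plateau on `[l' - δ', r' + δ']`. [folklore] -/
theorem plateau_at {g : 𝓢(ℝ, ℂ)} {l' r' δ' : ℝ}
    (hplat : ∀ x ∈ Set.Icc (l' - δ') (r' + δ'), g (x / (2 * Real.pi)) = 1) {ω : ℝ}
    (hω : ω ∈ Set.Icc l' r') : ∀ x ∈ Set.Icc (ω - δ') (ω + δ'), g (x / (2 * Real.pi)) = 1 :=
  fun x hx => hplat x ⟨by linarith [hx.1, hω.1], by linarith [hx.2, hω.2]⟩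

/-- **`‖(1 - Φ)(1 + (z - z₀) R(z))‖ ≤ 1 + 1/δ'`** for `|z - z₀| ≤ 1` (`‖1 - Φ‖ ≤ 1` and energy
localisation `‖(1 - Φ) R(z)‖ ≤ 1/δ'`). [cite: AmreinBoutetdeMonvelGeorgescu1996, Lemma 7.3.4] -/
theorem norm_one_sub_cutoff_mul_transition_le (U : OneParameterUnitaryGroup H) {g : 𝓢(ℝ, ℂ)}
    (hg : ∀ ξ, conj (g ξ) = g ξ) (h01 : ∀ ξ, 0 ≤ (g ξ).re ∧ (g ξ).re ≤ 1) {ω δ' : ℝ} (hδ : 0 < δ')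
    (hplat : ∀ x ∈ Set.Icc (ω - δ') (ω + δ'), g (x / (2 * Real.pi)) = 1) {z : ℂ} (hz : z.im ≠ 0)
    (hω : z.re = ω) {z₀ : ℂ} (hzz₀ : ‖z - z₀‖ ≤ 1) :
    ‖(1 - U.fourierCalculus g) * (1 + (z - z₀) • resolventAt U z)‖ ≤ 1 + δ'⁻¹ := by
  rw [mul_add, mul_one, mul_smul_comm]
  calc ‖(1 - U.fourierCalculus g) + (z - z₀) • ((1 - U.fourierCalculus g) * resolventAt U z)‖
      ≤ ‖1 - U.fourierCalculus g‖ + ‖(z - z₀) • ((1 - U.fourierCalculus g) * resolventAt U z)‖ :=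
        norm_add_le _ _
    _ ≤ 1 + 1 * δ'⁻¹ := by
        rw [norm_smul]
        gcongr
        · exact (norm_cutoff_le_one U hg h01).2
        · exact norm_one_sub_cutoff_mul_resolventAt_le U hg h01 hδ hplat hz hω
    _ = 1 + δ'⁻¹ := by ring

/-- **`‖(1 + (z - z₀) R(z))(1 - Φ)‖ ‖Φ‖ ≤ 1 + 1/δ'`** for `|z - z₀| ≤ 1` (`‖Φ‖, ‖1 - Φ‖ ≤ 1` and
`‖R(z)(1 - Φ)‖ ≤ 1/δ'`). [cite: AmreinBoutetdeMonvelGeorgescu1996, Lemma 7.3.4] -/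
theorem norm_transition_mul_one_sub_cutoff_mul_le (U : OneParameterUnitaryGroup H) {g : 𝓢(ℝ, ℂ)}
    (hg : ∀ ξ, conj (g ξ) = g ξ) (h01 : ∀ ξ, 0 ≤ (g ξ).re ∧ (g ξ).re ≤ 1) {ω δ' : ℝ} (hδ : 0 < δ')
    (hplat : ∀ x ∈ Set.Icc (ω - δ') (ω + δ'), g (x / (2 * Real.pi)) = 1) {z : ℂ} (hz : z.im ≠ 0)
    (hω : z.re = ω) {z₀ : ℂ} (hzz₀ : ‖z - z₀‖ ≤ 1) :
    ‖(1 + (z - z₀) • resolventAt U z) * (1 - U.fourierCalculus g)‖ * ‖U.fourierCalculus g‖ ≤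
      1 + δ'⁻¹ := by
  have h1 : ‖(1 + (z - z₀) • resolventAt U z) * (1 - U.fourierCalculus g)‖ ≤ 1 + δ'⁻¹ := by
    rw [add_mul, one_mul, smul_mul_assoc]
    calc ‖(1 - U.fourierCalculus g) + (z - z₀) • (resolventAt U z * (1 - U.fourierCalculus g))‖
        ≤ ‖1 - U.fourierCalculus g‖ +
            ‖(z - z₀) • (resolventAt U z * (1 - U.fourierCalculus g))‖ := norm_add_le _ _
      _ ≤ 1 + 1 * δ'⁻¹ := by
          rw [norm_smul]
          gcongr
          · exact (norm_cutoff_le_one U hg h01).2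
          · exact norm_resolventAt_mul_one_sub_cutoff_le U hg h01 hδ hplat hz hω
      _ = 1 + δ'⁻¹ := by ring
  calc _ ≤ (1 + δ'⁻¹) * 1 :=
        mul_le_mul h1 (norm_cutoff_le_one U hg h01).1 (norm_nonneg _) (by positivity)
    _ = 1 + δ'⁻¹ := mul_one _

/-! ## §3. The differential inequality at `(ω, ν, ε)` -/

/-- **The norm bound `‖G_ε(ω - iν)‖ ≤ C/ε`** for the plateau data, `0 < ε ≤ ε₀`, `ε ‖M‖ ≤ δ'/2`,
uniformly in `ω ∈ [l', r']`, `ν > 0` (`norm_mourreG_le_div_abs` with the energy localisation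
inequality at `z = ω - iν`). [cite: AmreinBoutetdeMonvelGeorgescu1996, Lemma 7.3.3 eq. (7.3.4)] -/
theorem norm_mourreG_plateau_le (U : OneParameterUnitaryGroup H) {A : OneParameterUnitaryGroup H}
    {g : 𝓢(ℝ, ℂ)} (hg : ∀ ξ, conj (g ξ) = g ξ) (h01 : ∀ ξ, 0 ≤ (g ξ).re ∧ (g ξ).re ≤ 1)
    {l' r' δ' : ℝ} (hδ : 0 < δ')
    (hplat : ∀ x ∈ Set.Icc (l' - δ') (r' + δ'), g (x / (2 * Real.pi)) = 1) {a : ℝ} (ha : 0 < a)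
    (hest : ∀ v : H, a * ‖U.fourierCalculus g v‖ ^ 2 ≤ (⟪v, U.mourreCommutator A g v⟫_ℂ).re)
    {ω : ℝ} (hω : ω ∈ Set.Icc l' r') {ν : ℝ} (hν : 0 < ν) {ε ε₀ : ℝ} (hε : 0 < ε) (hε₀ : ε ≤ ε₀)
    (hεM : ε * ‖U.mourreCommutator A g‖ ≤ δ' / 2) :
    ‖mourreG U (U.mourreCommutator A g) ε ((ω : ℂ) - I * ν)‖ ≤ (2 * a⁻¹ + 2 * δ'⁻¹ * ε₀) * ε⁻¹ := by
  have hz : ((ω : ℂ) - I * ν).im ≠ 0 := by rw [im_ofReal_sub_I_mul]; exact neg_ne_zero.2 hν.ne'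
  have hεz : ε * ((ω : ℂ) - I * ν).im ≤ 0 := by
    rw [im_ofReal_sub_I_mul]; exact mul_nonpos_of_nonneg_of_nonpos hε.le (neg_nonpos.2 hν.le)
  have hεM' : |ε| * ‖U.mourreCommutator A g‖ ≤ δ' / 2 := by rwa [abs_of_pos hε]
  have h := norm_mourreG_le_div_abs U ha hest hδ hz hεz
    (norm_sq_resolventAt_sub_norm_sq_cutoff_le U hg h01 hδ (plateau_at hplat hω) hz
      (re_ofReal_sub_I_mul ω ν)) hεM' hε.ne' (by rwa [abs_of_pos hε] : |ε| ≤ ε₀)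
  rwa [abs_of_pos hε] at h

/-- **Mourre's differential inequality at `(ω, ν, ε)`** (ABG (7.3.10)–(7.3.11)): for the plateau
data, `f ∈ D(A)`, `ω ∈ [l', r']`, `ν ∈ (0, 1]`, `0 < ε ≤ 1` with `ε ‖M‖ ≤ δ'/2`, and constants
`η₀, c₁, ψ₀` from the bookkeeping lemma (fed with `α = ‖A f‖`, `m = ‖M‖`, `m₁ = ‖[M, iA]‖`,
`c₀' = (1 + Ω)² ‖[R(-i), iA]‖`, `β = 1 + 1/δ'`, `n = ‖f‖`):
`‖⟪f, G_ε M G_ε f⟫‖ ≤ η₀ + c₁ (√ε)⁻¹ √‖⟪f, G_ε f⟫‖ + ψ₀ ‖⟪f, G_ε f⟫‖`, `G_ε = G_ε(ω - iν)`.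
[cite: AmreinBoutetdeMonvelGeorgescu1996, Thm. 7.3.1 eqs. (7.3.10)–(7.3.11)] -/
theorem mourre_differential_inequality_at {U A : OneParameterUnitaryGroup H}
    (hC1 : U.HamiltonianOfClassC1 A) {g : 𝓢(ℝ, ℂ)} (hg : ∀ ξ, conj (g ξ) = g ξ)
    (h01 : ∀ ξ, 0 ≤ (g ξ).re ∧ (g ξ).re ≤ 1) {l' r' δ' : ℝ} (hδ : 0 < δ')
    (hplat : ∀ x ∈ Set.Icc (l' - δ') (r' + δ'), g (x / (2 * Real.pi)) = 1)
    (hΦ : A.IsOfClassC1 (U.fourierCalculus g))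
    (hΦ₁ : A.IsOfClassC1 (U.fourierCalculus (energyMul g))) {a : ℝ} (ha : 0 < a)
    (hest : ∀ v : H, a * ‖U.fourierCalculus g v‖ ^ 2 ≤ (⟪v, U.mourreCommutator A g v⟫_ℂ).re)
    (hMC1 : A.IsOfClassC1 (U.mourreCommutator A g)) {f : H} (hf : f ∈ A.hamiltonian.domain)
    {Ω : ℝ} (hΩ : ∀ ω ∈ Set.Icc l' r', |ω| ≤ Ω) {η₀ c₁ ψ₀ : ℝ}
    (hbook : ∀ (c₀ b ε X Y Fn : ℝ), 0 ≤ c₀ →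
      c₀ ≤ (1 + Ω) ^ 2 * ‖A.commutatorCLM (resolventAt U (-I))‖ → 0 ≤ b → b ≤ 1 → 0 < ε →
      ε ≤ 1 → 0 ≤ X → 0 ≤ Y → 0 ≤ Fn →
      X ≤ Real.sqrt (2 * (a * ε)⁻¹) * Real.sqrt Fn + 2 * δ'⁻¹ * ‖f‖ →
      Y ≤ Real.sqrt (2 * (a * ε)⁻¹) * Real.sqrt Fn + 2 * δ'⁻¹ * ‖f‖ →
      ‖A.hamiltonian ⟨f, hf⟩‖ * (X + Y) + ε * ‖A.commutatorCLM (U.mourreCommutator A g)‖ * Y * X +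
          c₀ * ((1 + δ'⁻¹) * (‖f‖ + ε * ‖U.mourreCommutator A g‖ * Y) *
              (‖f‖ + (ε * ‖U.mourreCommutator A g‖ + b) * X) +
            (1 + δ'⁻¹) * (‖f‖ + (ε * ‖U.mourreCommutator A g‖ + b) * Y) *
              (‖f‖ + ε * ‖U.mourreCommutator A g‖ * X)) ≤
        η₀ + c₁ * (Real.sqrt ε)⁻¹ * Real.sqrt Fn + ψ₀ * Fn)
    {ω : ℝ} (hω : ω ∈ Set.Icc l' r') {ν : ℝ} (hν : ν ∈ Set.Ioc (0:ℝ) 1) {ε : ℝ} (hε : 0 < ε)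
    (hε1 : ε ≤ 1) (hεM : ε * ‖U.mourreCommutator A g‖ ≤ δ' / 2) :
    ‖⟪f, mourreG U (U.mourreCommutator A g) ε ((ω : ℂ) - I * ν)
        (U.mourreCommutator A g (mourreG U (U.mourreCommutator A g) ε ((ω : ℂ) - I * ν) f))⟫_ℂ‖ ≤
      η₀ + c₁ * (Real.sqrt ε)⁻¹ *
          Real.sqrt ‖⟪f, mourreG U (U.mourreCommutator A g) ε ((ω : ℂ) - I * ν) f⟫_ℂ‖ +
        ψ₀ * ‖⟪f, mourreG U (U.mourreCommutator A g) ε ((ω : ℂ) - I * ν) f⟫_ℂ‖ := by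
  set M := U.mourreCommutator A g with hMdef
  set z : ℂ := (ω : ℂ) - I * ν with hzdef
  set z₀ : ℂ := (ω : ℂ) - I with hz₀def
  have hMpos : ∀ v : H, 0 ≤ (⟪v, M v⟫_ℂ).re := re_inner_mourreCommutator_nonneg ha.le hest
  have hzlt : z.im < 0 := by rw [hzdef, im_ofReal_sub_I_mul]; exact neg_neg_of_pos hν.1
  have hz : z.im ≠ 0 := hzlt.ne
  have hzre : z.re = ω := re_ofReal_sub_I_mul ω ν
  have hz' : (conj z).im ≠ 0 := by rw [hzdef, im_conj_ofReal_sub_I_mul]; exact hν.1.ne'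
  have hzre' : (conj z).re = ω := re_conj_ofReal_sub_I_mul ω ν
  have hz₀ : z₀.im ≠ 0 := by rw [hz₀def, im_ofReal_sub_I]; norm_num
  have hεz : ε * z.im ≤ 0 := mul_nonpos_of_nonneg_of_nonpos hε.le hzlt.le
  have hεM' : |ε| * ‖M‖ ≤ δ' / 2 := by rwa [abs_of_pos hε]
  have hplatω := plateau_at hplat hω
  have hloc := norm_sq_resolventAt_sub_norm_sq_cutoff_le U hg h01 hδ hplatω hz hzre
  have hloc' := norm_sq_resolventAt_sub_norm_sq_cutoff_le U hg h01 hδ hplatω hz' hzre'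
  have hX := norm_mourreG_apply_le_sqrt U ha hest hδ hz hεz hloc hεM' hε.ne' f
  have hY := norm_adjoint_mourreG_apply_le_sqrt U ha hest hδ hz hεz hloc' hεM' hε.ne' f
  rw [abs_of_pos hε] at hX hY
  have hb : ‖z - z₀‖ ≤ 1 := by
    rw [hzdef, hz₀def, norm_ofReal_sub_I_mul_sub_ofReal_sub_I]
    exact abs_le.2 ⟨by linarith [hν.2], by linarith [hν.1]⟩
  have hB₁ := norm_one_sub_cutoff_mul_transition_le U hg h01 hδ hplatω hz hzre hb
  have hB₂ := norm_transition_mul_one_sub_cutoff_mul_le U hg h01 hδ hplatω hz hzre hb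
  have hR₀ : A.IsOfClassC1 (resolventAt U z₀) := isOfClassC1_resolventAt hC1 hz₀
  have h3b := norm_inner_mourreG_mul_mul_mourreG_le hMpos hz hεz hz₀ hMC1 hR₀
    (resolventAt_mul_energyShift U g hz) (energyShift_mul_resolventAt U g hz)
    (mourreCommutator_eq_neg_energyShift_mul hC1 hΦ hΦ₁ hz) hB₁ hB₂ hf
  rw [abs_of_pos hε] at h3b
  have hc₀ : ‖A.commutatorCLM (resolventAt U z₀)‖ ≤
      (1 + Ω) ^ 2 * ‖A.commutatorCLM (resolventAt U (-I))‖ :=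
    norm_commutatorCLM_resolventAt_ofReal_sub_I_le hC1 (hΩ ω hω)
  have key := hbook ‖A.commutatorCLM (resolventAt U z₀)‖ ‖z - z₀‖ ε ‖mourreG U M ε z f‖
    ‖ContinuousLinearMap.adjoint (mourreG U M ε z) f‖ ‖⟪f, mourreG U M ε z f⟫_ℂ‖ (norm_nonneg _)
    hc₀ (norm_nonneg _) hb hε hε1 (norm_nonneg _) (norm_nonneg _) (norm_nonneg _) hX hY
  exact h3b.trans key

/-! ## §4. The uniform bounds -/

omit [CompleteSpace H] in
/-- `‖⟪f, T f⟫‖ ≤ C ‖f‖²` when `‖T‖ ≤ C`. [folklore] -/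
theorem norm_inner_apply_self_le {T : H →L[ℂ] H} {C : ℝ} (hT : ‖T‖ ≤ C) (f : H) :
    ‖⟪f, T f⟫_ℂ‖ ≤ C * ‖f‖ ^ 2 :=
  calc ‖⟪f, T f⟫_ℂ‖ ≤ ‖f‖ * ‖T f‖ := norm_inner_le_norm f (T f)
    _ ≤ ‖f‖ * (C * ‖f‖) := by gcongr; exact T.le_of_opNorm_le hT f
    _ = C * ‖f‖ ^ 2 := by ring

/-- **The uniform bounds of Mourre's method** (ABG Thm. 7.3.1, the `C²` case, eqs.
(7.3.4), (7.3.10)–(7.3.12)): under the hypotheses of `stub_mourreThresholdLAP` — `H ∈ C¹(A)`,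
a strict Mourre estimate on `(l, r)` with constant `a > 0`, `φ(H)[H, iA]φ(H) ∈ C¹(A; H)` for
every admissible cutoff — for `f ∈ D(A)` and a compact window `[l', r'] ⊂ (l, r)` there are a
dissipative bounded `M` (the Mourre commutator of a plateau cutoff), `ε₀ > 0`, `C` and an
integrable `κ` on `(0, ε₀]` such that, uniformly in `ω ∈ [l', r']`, `ν ∈ (0, 1]`:
`‖G_ε(ω - iν)‖ ≤ C/ε` for `ε ∈ (0, ε₀]` and `‖⟪f, G_ε M G_ε f⟫‖ ≤ κ(ε)` for `ε ∈ (0, ε₀)`.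
[cite: AmreinBoutetdeMonvelGeorgescu1996, Thm. 7.3.1 eqs. (7.3.10)–(7.3.12)] -/
theorem exists_mourre_derivative_bounds {U A : OneParameterUnitaryGroup H} {l r a : ℝ}
    (ha : 0 < a) (hC1 : U.HamiltonianOfClassC1 A)
    (hMourre : U.HasMourreEstimateOn A (Set.Ioo l r) a)
    (hC2 : ∀ g : 𝓢(ℝ, ℂ), IsRealCutoffOn (Set.Ioo l r) g → A.IsOfClassC1 (U.mourreCommutator A g))
    {f : H} (hf : f ∈ A.hamiltonian.domain) {l' r' : ℝ} (hl : l < l') (hl' : l' ≤ r')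
    (hr : r' < r) :
    ∃ (M : H →L[ℂ] H) (ε₀ C : ℝ) (κ : ℝ → ℝ), (∀ v : H, 0 ≤ (⟪v, M v⟫_ℂ).re) ∧ 0 < ε₀ ∧
      IntegrableOn κ (Set.Ioc 0 ε₀) ∧
      (∀ ω ∈ Set.Icc l' r', ∀ ν ∈ Set.Ioc (0:ℝ) 1, ∀ ε ∈ Set.Ioc 0 ε₀,
        ‖mourreG U M ε ((ω : ℂ) - I * ν)‖ ≤ C * ε⁻¹) ∧
      (∀ ω ∈ Set.Icc l' r', ∀ ν ∈ Set.Ioc (0:ℝ) 1, ∀ ε ∈ Set.Ioo 0 ε₀,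
        ‖⟪f, mourreG U M ε ((ω : ℂ) - I * ν) (M (mourreG U M ε ((ω : ℂ) - I * ν) f))⟫_ℂ‖ ≤
          κ ε) := by
  -- the window margin `δ'` and the plateau cutoff
  obtain ⟨δ', hδ'⟩ : ∃ δ' : ℝ, δ' = min (l' - l) (r - r') / 2 := ⟨_, rfl⟩
  have hδ : 0 < δ' := by rw [hδ']; exact half_pos (lt_min (by linarith) (by linarith))
  have hδl : δ' < l' - l := by
    rw [hδ']; linarith [min_le_left (l' - l) (r - r'), show 0 < l' - l by linarith]
  have hδr : δ' < r - r' := by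
    rw [hδ']; linarith [min_le_right (l' - l) (r - r'), show 0 < r - r' by linarith]
  obtain ⟨g, hg, h01, hplat⟩ := exists_plateauCutoff (l := l) (l₁ := l' - δ') (r₁ := r' + δ')
    (r := r) (by linarith) (by linarith) (by linarith)
  have h01' : ∀ ξ, 0 ≤ (g ξ).re ∧ (g ξ).re ≤ 1 := fun ξ => ⟨(h01 ξ).1, (h01 ξ).2.1⟩
  obtain ⟨hΦ, hΦ₁, hest⟩ := hMourre g hg
  have hMC1 : A.IsOfClassC1 (U.mourreCommutator A g) := hC2 g hg
  set M := U.mourreCommutator A g with hMdef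
  have hMpos : ∀ v : H, 0 ≤ (⟪v, M v⟫_ℂ).re := re_inner_mourreCommutator_nonneg ha.le hest
  -- `ε₀`
  obtain ⟨ε₀, hε₀def⟩ : ∃ ε₀ : ℝ, ε₀ = min 1 (δ' / (2 * (‖M‖ + 1))) := ⟨_, rfl⟩
  have hε₀ : 0 < ε₀ := by rw [hε₀def]; exact lt_min one_pos (by positivity)
  have hε₀1 : ε₀ ≤ 1 := by rw [hε₀def]; exact min_le_left _ _
  have hε₀M : ε₀ * ‖M‖ ≤ δ' / 2 := by
    have h2 : ε₀ ≤ δ' / (2 * (‖M‖ + 1)) := by rw [hε₀def]; exact min_le_right _ _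
    calc ε₀ * ‖M‖ ≤ δ' / (2 * (‖M‖ + 1)) * ‖M‖ := by gcongr
      _ ≤ δ' / (2 * (‖M‖ + 1)) * (‖M‖ + 1) := by gcongr; linarith
      _ = δ' / 2 := by field_simp
  have hεM : ∀ {ε : ℝ}, 0 < ε → ε ≤ ε₀ → ε * ‖M‖ ≤ δ' / 2 := fun hε hεle =>
    (mul_le_mul_of_nonneg_right hεle (norm_nonneg _)).trans hε₀M
  -- the constants of the differential inequality
  obtain ⟨Ω, hΩdef⟩ : ∃ Ω : ℝ, Ω = max |l'| |r'| := ⟨_, rfl⟩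
  have hΩ : ∀ ω ∈ Set.Icc l' r', |ω| ≤ Ω := fun ω hω => by
    rw [hΩdef]
    exact abs_le_max_abs_abs hω.1 hω.2
  have hΩ0 : 0 ≤ Ω := by rw [hΩdef]; exact le_max_of_le_left (abs_nonneg _)
  obtain ⟨η₀, c₁, ψ₀, hη₀, hc₁, hψ₀, hbook⟩ := exists_mourre_bookkeeping_constants
    (α := ‖A.hamiltonian ⟨f, hf⟩‖) (m := ‖M‖) (m₁ := ‖A.commutatorCLM M‖)
    (c₀' := (1 + Ω) ^ 2 * ‖A.commutatorCLM (resolventAt U (-I))‖) (β := 1 + δ'⁻¹) (n := ‖f‖)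
    (norm_nonneg _) (norm_nonneg _) (norm_nonneg _) (by positivity) (by positivity)
    (norm_nonneg _) ha hδ
  -- the differential inequality and the norm bound, uniformly in `(ω, ν)`
  have hDI : ∀ ω ∈ Set.Icc l' r', ∀ ν ∈ Set.Ioc (0:ℝ) 1, ∀ ε ∈ Set.Ioc 0 ε₀,
      ‖⟪f, mourreG U M ε ((ω : ℂ) - I * ν) (M (mourreG U M ε ((ω : ℂ) - I * ν) f))⟫_ℂ‖ ≤
        η₀ + c₁ * (Real.sqrt ε)⁻¹ * Real.sqrt ‖⟪f, mourreG U M ε ((ω : ℂ) - I * ν) f⟫_ℂ‖ +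
          ψ₀ * ‖⟪f, mourreG U M ε ((ω : ℂ) - I * ν) f⟫_ℂ‖ := fun ω hω ν hν ε hε =>
    mourre_differential_inequality_at hC1 hg.1 h01' hδ hplat hΦ hΦ₁ ha hest hMC1 hf hΩ hbook hω
      hν hε.1 (hε.2.trans hε₀1) (hεM hε.1 hε.2)
  obtain ⟨C, hCdef⟩ : ∃ C : ℝ, C = 2 * a⁻¹ + 2 * δ'⁻¹ * ε₀ := ⟨_, rfl⟩
  have hC : ∀ ω ∈ Set.Icc l' r', ∀ ν ∈ Set.Ioc (0:ℝ) 1, ∀ ε ∈ Set.Ioc 0 ε₀,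
      ‖mourreG U M ε ((ω : ℂ) - I * ν)‖ ≤ C * ε⁻¹ := fun ω hω ν hν ε hε => by
    rw [hCdef]
    exact norm_mourreG_plateau_le U hg.1 h01' hδ hplat ha hest hω hν.1 hε.1 hε.2 (hεM hε.1 hε.2)
  -- Gronwall
  obtain ⟨B, hBdef⟩ : ∃ B : ℝ, B = C * ε₀⁻¹ * ‖f‖ ^ 2 := ⟨_, rfl⟩
  obtain ⟨C₁, hC₁def⟩ : ∃ C₁ : ℝ,
      C₁ = 2 * (B + ε₀ * η₀ + (c₁ * (2 * Real.sqrt ε₀)) ^ 2) * Real.exp (ε₀ * ψ₀) := ⟨_, rfl⟩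
  refine ⟨M, ε₀, C, fun ε => η₀ + c₁ * Real.sqrt C₁ * (Real.sqrt ε)⁻¹ + ψ₀ * C₁, hMpos, hε₀,
    integrableOn_const_add_mul_inv_sqrt _ _ _ _, hC, ?_⟩
  intro ω hω ν hν ε hε
  have hzlt : ((ω : ℂ) - I * ν).im < 0 := by rw [im_ofReal_sub_I_mul]; exact neg_neg_of_pos hν.1
  have hB : ‖⟪f, mourreG U M ε₀ ((ω : ℂ) - I * ν) f⟫_ℂ‖ ≤ B := by
    rw [hBdef]
    exact norm_inner_apply_self_le (hC ω hω ν hν ε₀ ⟨hε₀, le_rfl⟩) f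
  have h := norm_inner_mourreG_mul_mul_le_of_differential_inequality hMpos hzlt U f hε₀ hη₀ hc₁
    hψ₀ hB (fun ε' hε' => hDI ω hω ν hν ε' ⟨hε'.1, hε'.2.le⟩) ε hε
  rw [hC₁def]
  exact h

/-! ## §5. Headline (registered helper stub) -/

/-- **The uniform bounds of Mourre's method, headline form** (all binders explicit; registered
helper stub of `stub_mourreThresholdLAP`, S6-PLAN F4): under the hypotheses of the stub
(`H ∈ C¹(A)`, a strict Mourre estimate on `(l, r)` with constant `a > 0`,
`φ(H)[H, iA]φ(H) ∈ C¹(A; H)` for admissible cutoffs), for `f ∈ D(A)` and `[l', r'] ⊂ (l, r)`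
there are a dissipative bounded `M`, `ε₀ > 0`, `C` and an integrable `κ` on `(0, ε₀]` with
`‖G_ε(ω - iν)‖ ≤ C/ε` (`ε ∈ (0, ε₀]`) and `‖⟪f, G_ε M G_ε f⟫‖ ≤ κ(ε)` (`ε ∈ (0, ε₀)`) uniformly
in `ω ∈ [l', r']`, `ν ∈ (0, 1]` (`G_ε = mourreG U M ε (ω - iν)`).
[cite: AmreinBoutetdeMonvelGeorgescu1996, Thm. 7.3.1 eqs. (7.3.10)–(7.3.12)] -/
theorem mourre_derivative_bounds :
    ∀ (K : Type) [NormedAddCommGroup K] [InnerProductSpace ℂ K] [CompleteSpace K]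
      (U A : Literature.Analysis.UnboundedOperators.OneParameterUnitaryGroup K) (l r a : ℝ),
      0 < a → U.HamiltonianOfClassC1 A → U.HasMourreEstimateOn A (Set.Ioo l r) a →
      (∀ g : SchwartzMap ℝ ℂ,
        Literature.Analysis.UnboundedOperators.UnitaryRep.IsRealCutoffOn (Set.Ioo l r) g →
          A.IsOfClassC1 (U.mourreCommutator A g)) →
      ∀ (f : K), f ∈ A.hamiltonian.domain → ∀ (l' r' : ℝ), l < l' → l' ≤ r' → r' < r →
        ∃ (M : K →L[ℂ] K) (ε₀ C : ℝ) (κ : ℝ → ℝ), (∀ v : K, 0 ≤ (inner ℂ v (M v)).re) ∧ 0 < ε₀ ∧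
          MeasureTheory.IntegrableOn κ (Set.Ioc 0 ε₀) MeasureTheory.volume ∧
          (∀ ω ∈ Set.Icc l' r', ∀ ν ∈ Set.Ioc (0:ℝ) 1, ∀ ε ∈ Set.Ioc 0 ε₀,
            ‖Summit.AtomisticToContinuum.FouriersLaw.Theorems.MourreDissolution.mourreG U M ε
                ((ω : ℂ) - Complex.I * (ν : ℂ))‖ ≤ C * ε⁻¹) ∧
          (∀ ω ∈ Set.Icc l' r', ∀ ν ∈ Set.Ioc (0:ℝ) 1, ∀ ε ∈ Set.Ioo 0 ε₀,
            ‖inner ℂ f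
                (Summit.AtomisticToContinuum.FouriersLaw.Theorems.MourreDissolution.mourreG U M ε
                  ((ω : ℂ) - Complex.I * (ν : ℂ))
                  (M (Summit.AtomisticToContinuum.FouriersLaw.Theorems.MourreDissolution.mourreG U M ε
                    ((ω : ℂ) - Complex.I * (ν : ℂ)) f)))‖ ≤ κ ε) := by
  intro K _ _ _ U A l r a ha hC1 hMourre hC2 f hf l' r' hl hl' hr
  exact exists_mourre_derivative_bounds ha hC1 hMourre hC2 hf hl hl' hr

end Summit.AtomisticToContinuum.FouriersLaw.Theorems.MourreDissolution
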